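import Literature.AnabelianGeometry.EtaleTheta.SettingModelChiTheta
import Literature.AnabelianGeometry.EtaleTheta.SettingModelChiCuspGroupLevel
import Literature.AnabelianGeometry.EtaleTheta.SettingBridge
import Literature.AnabelianGeometry.EtaleTheta.Discharge.Sec1OriginOfFree
import HarnessLib

/-!
# The χ-twisted root model of [EtTh] §1 WITH A CUSP: root + guard + `hYcl` + a FULLY INHABITED `OncePuncturedData`,
# hence an `OncePuncturedTemperedGroup ℚ_p`-datum with non-split `Π^tp_X = Γ ⋊_χ G_{ℚ_p}` and a genuine cusp torsor

Mochizuki, *The étale theta function …*, Publ. RIMS **45** (2009) [EtTh], §1, PRIMS pp. 237–239 («`Π^tp_X`»,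
«`Π^tp_X ↠ Z`», «`1 → Δ_X → Π_X → G_K → 1`», «any decomposition group of a cusp of `Y^log`»)
[cite: MochizukiEtTh2009, §1 p.13]; *Semi-graphs of anabelioids*, Publ. RIMS **42** (2006) [SemiAnbd], Ex. 3.10
pp. 43–45, §6 p. 71 [cite: MochizukiSemiAnbd2006, Ex 3.10 p.45].  abc-iut cell, seat abc-iut-w5-d111 (gen 4); R78
cluster (S2).  PROOF-ONLY (0 definitions): the `ThetaSetting` record of abc-iut-L2-t1's F5b `ThetaSetting.modelχ p`
(SettingModelChiTheta) UPDATED along abc-iut-w5-d029's cusped carrier `curveχ′ p` (SettingModelChiCusp; same `K`,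
`Π^tp`, `aug`, `Π`, `toHat` — every other field of `modelχ` is kept verbatim) is built INSIDE the proofs, and:

* **`exists_thetaSetting_curveχ'`** — there is a `ThetaSetting p` over `curveχ′ p` satisfying the guard
  `IsEtThOrigin`, the root clause `hYcl`, «`aug` open», and carrying a FULLY INHABITED parameter bundle
  `OncePuncturedData` ((P1) `ker_augHat` = abc-iut-w5-d139's theorem at this seat's `GroupLevelData`; (P2)–(P4) =
  abc-iut-w5-d029's cusp clauses; (P5) = `IsEtThOrigin.of_free`; the `GroupLevelData` = this seat's
  `nonempty_groupLevelData_curveχ'_holds`) — NO binder anywhere;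
* **`exists_oncePuncturedTemperedGroup_chi`** — hence, through abc-iut-L2's bridge `toOncePuncturedTemperedGroup`,
  abc-iut-L3's interface `OncePuncturedTemperedGroup K` ([EtTh] §1 / [SemiAnbd] Ex. 3.10 as typed in
  `TemperedCurves.lean`) has an inhabitant over `K = ℚ_p` (`↥⊥ ⊆ ℚ̄_p`) whose `Π` is the NON-split, Galois-twisted
  `Γ ⋊_χ G_{ℚ_p}` (tempered, slim, Galois-countable, `Δ = Γ = F̂₂ ×_Ẑ ℤ` genuinely tempered) and whose cusp family is
  the `Π^tp_X`-conjugacy class of `b^Ẑ ⋊ G_{ℚ_p}` (a genuine torsor, not a single normal subgroup) — removing the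
  two degeneracies labelled in abc-iut-w5-d218's `OncePuncturedTemperedGroupPadicWitness` («`Π` is a PRODUCT … the
  cusp family is a single normal subgroup»).
HONEST LABEL: SEMI-SYNTHETIC model — not the tempered `π₁` of a once-punctured elliptic curve (the cusp inertia is the
Tate-twisted `b`-axis, see SettingModelChiCusp); CONSISTENCY EVIDENCE for the axiom packages only; classical
profinite/tempered group theory; nothing of [EtTh]/[SemiAnbd] asserted; no side taken on [IUTchIII] Cor. 3.12.
-/

noncomputable section

namespace Literature.AnabelianGeometry.EtaleTheta.SettingModel

open Literature.AnabelianGeometry.SemiGraphs Literature.AlgebraicGeometry.Frobenioids _root_.Topology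

variable (p : ℕ) [Fact p.Prime]

/-- **A `ThetaSetting` over the CUSPED χ-carrier with everything inhabited**: over `curveχ′ p` there is a root record
`D` (F5b's `modelχ` with `toTemperedCurve := curveχ′ p`) with `D.IsEtThOrigin`, `hYcl`, `IsOpenMap D.aug`, and
`Nonempty D.OncePuncturedData` — the [EtTh] §1 root package «(P1)–(P5) + η′» holds at a model with NON-trivial Galois
action on `Δ_Θ`. [cite: MochizukiEtTh2009, §1 p.13] -/
theorem exists_thetaSetting_curveχ' :
    ∃ D : ThetaSetting p, D.toTemperedCurve = curveχ' p ∧ D.IsEtThOrigin ∧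
      (D.DtpY.map D.toHat.toMonoidHom).topologicalClosure ≤
        D.DtpY.map D.toHat.toMonoidHom ⊔ (⁅⁅D.DeltaHat, D.DeltaHat⁆, D.DeltaHat⁆).topologicalClosure ∧
      IsOpenMap D.aug ∧ Nonempty D.OncePuncturedData := by
  let D : ThetaSetting p := { ThetaSetting.modelχ p with toTemperedCurve := curveχ' p }
  have horigin : D.IsEtThOrigin := ThetaSetting.IsEtThOrigin.of_free (isFreeProfiniteOnTwo_deltaHatχ p)
  refine ⟨D, rfl, horigin, hYcl_modelχ p, isOpenMap_augχ p, ⟨?_⟩⟩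
  exact
    { toGroupLevelData := (nonempty_groupLevelData_curveχ'_holds p).some
      ker_augHat := ker_augHat_eq_deltaHat_curveχ' p
      exists_cusp := exists_isCusp_curveχ' p
      decomp_le_ker_toZ := fun x _ g hg => by
        rw [MonoidHom.mem_ker]
        exact gfpSnd_left_eq_one_of_mem_decomp_curveχ' p x hg
      map_aug_decomp := fun x _ => map_aug_decomp_curveχ' p x
      origin := horigin }

/-- **`OncePuncturedTemperedGroup ℚ_p` is inhabited by the cusped χ-model** (through abc-iut-L2's bridge
`ThetaSetting.toOncePuncturedTemperedGroup`): `Π = Γ ⋊_χ G_{ℚ_p}` non-split with the cyclotomic twist, `Δ = Γ`,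
`Π ↠ ℤ` the degree, `Π̂ = F̂₂ ⋊_χ G_{ℚ_p}`, cusp family = the conjugates of `b^Ẑ ⋊ G_{ℚ_p}`.
[cite: MochizukiEtTh2009, §1 pp.237-239] -/
theorem exists_oncePuncturedTemperedGroup_chi :
    ∃ T : OncePuncturedTemperedGroup (curveχ' p).K, T.Pi = PiTpχ p := by
  let D : ThetaSetting p := { ThetaSetting.modelχ p with toTemperedCurve := curveχ' p }
  have horigin : D.IsEtThOrigin := ThetaSetting.IsEtThOrigin.of_free (isFreeProfiniteOnTwo_deltaHatχ p)
  let e : D.OncePuncturedData :=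
    { toGroupLevelData := (nonempty_groupLevelData_curveχ'_holds p).some
      ker_augHat := ker_augHat_eq_deltaHat_curveχ' p
      exists_cusp := exists_isCusp_curveχ' p
      decomp_le_ker_toZ := fun x _ g hg => by
        rw [MonoidHom.mem_ker]
        exact gfpSnd_left_eq_one_of_mem_decomp_curveχ' p x hg
      map_aug_decomp := fun x _ => map_aug_decomp_curveχ' p x
      origin := horigin }
  exact ⟨D.toOncePuncturedTemperedGroup e, rfl⟩

/-- In particular the L3 interface `OncePuncturedTemperedGroup K` is inhabited over the base field of the χ-model
(`K = ℚ_p` as the bottom intermediate field of `ℚ̄_p/ℚ_p`). [cite: MochizukiEtTh2009, §1 pp.237-239] -/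
theorem nonempty_oncePuncturedTemperedGroup_chi : Nonempty (OncePuncturedTemperedGroup (curveχ' p).K) := by
  obtain ⟨T, -⟩ := exists_oncePuncturedTemperedGroup_chi p
  exact ⟨T⟩

end Literature.AnabelianGeometry.EtaleTheta.SettingModel

end
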